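import Mathlib
import Literature.Computability.AlgebraicComplexity.LR21TorusWeights
import Literature.Computability.AlgebraicComplexity.LR21Datum
import Summits.ValiantsHypothesis.ValiantsHypothesis.Theorems.RigidityForcesSymmetryPairTiedTorusBoundDefs

/-!
# Crux `OrbitDimensionBound` (stmt-ValiantsHypothesis-16133), line `affine_multiple`, stub `stub_perInvariantTorusBound` —
# step 1: typing by unique factorisation for the PER-INVARIANT torus `T¹ = {diag(d_k e_l) : ∏ d ∏ e = 1}`

Route `ValiantsHypothesis/FreeSubtorus`, registered skeleton `Cruxes/OrbitDimensionBound/Lines/affine_multiple.lean`, stub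
`stub_perInvariantTorusBound` (helper 1 of its proof).  The dictionary of crux 18034's line `PairTiedTorusBound`
(`…RankRigidMinimalReprSpectralGauge/PathExpansion/WeightTyping/LevelNodes/StubLevelDecomp.lean`) is run with the generic element of
`T¹` in place of the tied-torus element: rows scaled by the primes `p_k = primes₂ (inl k)`, the columns `j ≠ last` by the primes
`q_j = primes₂ (inr j)`, and the LAST column by `Ω⁻¹`, `Ω = ∏_k p_k · ∏_{j ≠ last} q_j`, so that `∏ d · ∏ e = 1`.

This file is the `T¹` analogue of `WeightTyping.typed_of_weights`.  The weight of a monomial `x^δ` is `N(δ) · Ω^{-c_last(δ)}` with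
`N(δ) = ∏_k p_k^{r_k(δ)} ∏_{j ≠ last} q_j^{c_j(δ)}` (row degrees `r`, column degrees `c`), so the pairing identity
«weight(δ) · weight(δ') = character = 1» of the dictionary reads, cleared of denominators, `N(δ) N(δ') = Ω^{c_last(δ) + c_last(δ')}` IN `ℕ`.
`typed_of_perInvariant_weights`: if all pairs `x^δ ∈ supp P`, `x^δ' ∈ supp Q` satisfy it, `P ≠ 0 ≠ Q`, the monomials of `P` have
degree `s` and those of `Q` degree `n - s`, then unique factorisation (`LRPencil.eq_of_prod_prime_pow_eq_fintype`) gives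
`r(δ) + r(δ') = c(δ) + c(δ') = (t, …, t)` with `t = c_last(δ) + c_last(δ')`, and the DEGREES PIN `t = 1` (`n·t = s + (n - s)`); hence
`P`, `Q` are typed by complementary row SETS and complementary `0/1` column profiles — `IsTiedTyped n 0 …` (tree copy
`…PairTiedTorusBoundDefs`, the tie `k = 0` being vacuous) — with `|I| = s`.

HONEST FRAMING: helper toward ONE registered stub of a forward rung inside one route; the crux `OrbitDimensionBound` stays OPEN;
census-neutral; `VP ≠ VNP` is NOT proved and nothing here bears on it.
-/

set_option autoImplicit false

-- the mandated summit-side namespace repeats a component by design (single-problem summit)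
set_option linter.dupNamespace false

noncomputable section

open MvPolynomial Finset
open Literature.Computability.AlgebraicComplexity LRPencil
open Summit.ValiantsHypothesis.ValiantsHypothesis.Theorems.RigidityForcesSymmetryPairTiedTorusBound

namespace Summit.ValiantsHypothesis.ValiantsHypothesis.Theorems.FreeSubtorusOrbitDimensionBound

namespace PerInvariantTyping

variable {n : ℕ}

/-- The exponent bookkeeping of `N(δ) = ∏_k p_k^{r_k(δ)} · ∏_{j ≠ last} q_j^{c_j(δ)}`: row degrees at `inl k`, column degrees at
`inr j` for `j ≠ last`, and `0` at the last column (whose scalar `Ω⁻¹` is not a prime). -/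
theorem prod_weightN_eq_prod_primes_pow (δ : (Fin (n + 1) × Fin (n + 1)) →₀ ℕ) :
    ((∏ k : Fin (n + 1), primes₂ (n + 1) (Sum.inl k) ^ (∑ j, δ (k, j))) *
        ∏ j : Fin n, primes₂ (n + 1) (Sum.inr (Fin.castSucc j)) ^ (∑ k, δ (k, Fin.castSucc j))) =
      ∏ x : Fin (n + 1) ⊕ Fin (n + 1), primes₂ (n + 1) x ^
        (Sum.elim (fun k => ∑ j, δ (k, j)) (fun j => if j = Fin.last n then 0 else ∑ k, δ (k, j)) x) := by
  rw [Fintype.prod_sum_type]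
  simp only [Sum.elim_inl, Sum.elim_inr]
  congr 1
  rw [Fin.prod_univ_castSucc, if_pos rfl, pow_zero, mul_one]
  exact Finset.prod_congr rfl fun j _ => by rw [if_neg (Fin.castSucc_lt_last j).ne]

/-- `Ω^t = ∏_k p_k^t · ∏_{j ≠ last} q_j^t` in the same bookkeeping. -/
theorem omega_pow_eq_prod_primes_pow (t : ℕ) :
    (((∏ k : Fin (n + 1), primes₂ (n + 1) (Sum.inl k)) *
        ∏ j : Fin n, primes₂ (n + 1) (Sum.inr (Fin.castSucc j))) ^ t) =
      ∏ x : Fin (n + 1) ⊕ Fin (n + 1), primes₂ (n + 1) x ^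
        (Sum.elim (fun _ => t) (fun j => if j = Fin.last n then 0 else t) x) := by
  rw [Fintype.prod_sum_type, mul_pow, ← Finset.prod_pow, ← Finset.prod_pow]
  simp only [Sum.elim_inl, Sum.elim_inr]
  congr 1
  rw [Fin.prod_univ_castSucc, if_pos rfl, pow_zero, mul_one]
  exact Finset.prod_congr rfl fun j _ => by rw [if_neg (Fin.castSucc_lt_last j).ne]

/-- The degree of a monomial is the sum of its column degrees, the last column split off. -/
theorem sum_eq_sum_cols (δ : (Fin (n + 1) × Fin (n + 1)) →₀ ℕ) :
    (∑ v, δ v) = (∑ j : Fin n, ∑ k, δ (k, Fin.castSucc j)) + ∑ k, δ (k, Fin.last n) := by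
  rw [Fintype.sum_prod_type_right, Fin.sum_univ_castSucc]

/-- The degree of a monomial is the sum of its row degrees. -/
theorem sum_eq_sum_rows (δ : (Fin (n + 1) × Fin (n + 1)) →₀ ℕ) :
    (∑ v, δ v) = ∑ k, ∑ j, δ (k, j) := by
  rw [Fintype.sum_prod_type]

/-- **Typing by unique factorisation on the per-invariant torus.**  See the module docstring: the pairing identity
`N(δ) N(δ') = Ω^{c_last(δ) + c_last(δ')}` for all `x^δ ∈ supp P`, `x^δ' ∈ supp Q`, with `deg P = s`, `deg Q = n + 1 - s`, forces
complementary `0/1` row and column typings: `IsTiedTyped (n+1) 0` data with `|I| = s`. -/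
theorem typed_of_perInvariant_weights {P Q : MvPolynomial (Fin (n + 1) × Fin (n + 1)) ℂ}
    (hPQ : ∀ δ ∈ P.support, ∀ δ' ∈ Q.support,
      ((∏ k : Fin (n + 1), primes₂ (n + 1) (Sum.inl k) ^ (∑ j, δ (k, j))) *
          ∏ j : Fin n, primes₂ (n + 1) (Sum.inr (Fin.castSucc j)) ^ (∑ k, δ (k, Fin.castSucc j))) *
        ((∏ k : Fin (n + 1), primes₂ (n + 1) (Sum.inl k) ^ (∑ j, δ' (k, j))) *
          ∏ j : Fin n, primes₂ (n + 1) (Sum.inr (Fin.castSucc j)) ^ (∑ k, δ' (k, Fin.castSucc j))) =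
      ((∏ k : Fin (n + 1), primes₂ (n + 1) (Sum.inl k)) *
          ∏ j : Fin n, primes₂ (n + 1) (Sum.inr (Fin.castSucc j))) ^
        ((∑ k, δ (k, Fin.last n)) + ∑ k, δ' (k, Fin.last n)))
    (hP : P ≠ 0) (hQ : Q ≠ 0) {s : ℕ} (hdegP : ∀ δ ∈ P.support, (∑ v, δ v) = s)
    (hdegQ : ∀ δ' ∈ Q.support, (∑ v, δ' v) + s = n + 1) :
    ∃ (I : Finset (Fin (n + 1))) (c c' : Fin (n + 1) → ℕ) (ct ct' : ℕ), I.card = s ∧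
      IsTiedTyped (n + 1) 0 I c ct P ∧ IsTiedTyped (n + 1) 0 Iᶜ c' ct' Q ∧
      (∀ j : Fin (n + 1), 0 < j.val → c j + c' j = 1) ∧
      ct + ct' = (univ.filter fun j : Fin (n + 1) => j.val ≤ 0).card := by
  classical
  -- bookkeeping
  set E : ((Fin (n + 1) × Fin (n + 1)) →₀ ℕ) → (Fin (n + 1) ⊕ Fin (n + 1) → ℕ) := fun δ =>
    Sum.elim (fun k => ∑ j, δ (k, j)) (fun j => if j = Fin.last n then 0 else ∑ k, δ (k, j)) with hE
  set cl : ((Fin (n + 1) × Fin (n + 1)) →₀ ℕ) → ℕ := fun δ => ∑ k, δ (k, Fin.last n) with hcl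
  -- unique factorisation: `E δ + E δ' = (t,…,t ; t,…,t,0)` with `t = cl δ + cl δ'`
  have key : ∀ δ ∈ P.support, ∀ δ' ∈ Q.support,
      E δ + E δ' = Sum.elim (fun _ => cl δ + cl δ') (fun j => if j = Fin.last n then 0 else cl δ + cl δ') := by
    intro δ hδ δ' hδ'
    have h := hPQ δ hδ δ' hδ'
    rw [prod_weightN_eq_prod_primes_pow δ, prod_weightN_eq_prod_primes_pow δ', omega_pow_eq_prod_primes_pow,
      ← Finset.prod_mul_distrib] at h
    have h' : ∏ x, primes₂ (n + 1) x ^ (E δ + E δ') x =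
        ∏ x, primes₂ (n + 1) x ^ (Sum.elim (fun _ => cl δ + cl δ')
          (fun j => if j = Fin.last n then 0 else cl δ + cl δ') x) := by
      rw [← h]
      exact Finset.prod_congr rfl fun x _ => by rw [Pi.add_apply, pow_add]
    exact eq_of_prod_prime_pow_eq_fintype (primes₂_prime (n + 1)) (primes₂_injective (n + 1)) h'
  -- the degrees pin `cl δ + cl δ' = 1`
  have hone : ∀ δ ∈ P.support, ∀ δ' ∈ Q.support, cl δ + cl δ' = 1 := by
    intro δ hδ δ' hδ'
    have h := key δ hδ δ' hδ'
    have hrows : ∀ k : Fin (n + 1), (∑ j, δ (k, j)) + ∑ j, δ' (k, j) = cl δ + cl δ' := fun k => by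
      have := congrFun h (Sum.inl k); simpa [hE] using this
    have hsum : (∑ v, δ v) + ∑ v, δ' v = (n + 1) * (cl δ + cl δ') := by
      rw [sum_eq_sum_rows, sum_eq_sum_rows, ← Finset.sum_add_distrib, Finset.sum_congr rfl fun k _ => hrows k,
        Finset.sum_const, Finset.card_univ, Fintype.card_fin, smul_eq_mul]
    have h2 : (∑ v, δ v) + ∑ v, δ' v = n + 1 := by have := hdegQ δ' hδ'; have := hdegP δ hδ; omega
    rw [h2] at hsum
    have : 1 ≤ cl δ + cl δ' := by
      by_contra! h0
      have : cl δ + cl δ' = 0 := by omega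
      rw [this, mul_zero] at hsum
      omega
    nlinarith
  -- complementary bookkeeping, all entries `0/1`
  have hrow : ∀ δ ∈ P.support, ∀ δ' ∈ Q.support, ∀ k : Fin (n + 1), (∑ j, δ (k, j)) + ∑ j, δ' (k, j) = 1 := by
    intro δ hδ δ' hδ' k
    have := congrFun (key δ hδ δ' hδ') (Sum.inl k)
    simp only [Pi.add_apply, hE, Sum.elim_inl] at this
    rw [this, hone δ hδ δ' hδ']
  have hcolc : ∀ δ ∈ P.support, ∀ δ' ∈ Q.support, ∀ j : Fin n,
      (∑ k, δ (k, Fin.castSucc j)) + ∑ k, δ' (k, Fin.castSucc j) = 1 := by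
    intro δ hδ δ' hδ' j
    have := congrFun (key δ hδ δ' hδ') (Sum.inr (Fin.castSucc j))
    simp only [Pi.add_apply, hE, Sum.elim_inr, if_neg (Fin.castSucc_lt_last j).ne] at this
    rw [this, hone δ hδ δ' hδ']
  have hcoll : ∀ δ ∈ P.support, ∀ δ' ∈ Q.support,
      (∑ k, δ (k, Fin.last n)) + ∑ k, δ' (k, Fin.last n) = 1 := fun δ hδ δ' hδ' => hone δ hδ δ' hδ'
  have hcol : ∀ δ ∈ P.support, ∀ δ' ∈ Q.support, ∀ j : Fin (n + 1), (∑ k, δ (k, j)) + ∑ k, δ' (k, j) = 1 := by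
    intro δ hδ δ' hδ' j
    rcases Fin.eq_castSucc_or_eq_last j with ⟨j', rfl⟩ | rfl
    · exact hcolc δ hδ δ' hδ' j'
    · exact hcoll δ hδ δ' hδ'
  obtain ⟨δ₀, hδ₀⟩ : ∃ δ₀, δ₀ ∈ P.support := by
    obtain ⟨d, hd⟩ := MvPolynomial.ne_zero_iff.1 hP; exact ⟨d, MvPolynomial.mem_support_iff.2 hd⟩
  obtain ⟨δ₀', hδ₀'⟩ : ∃ δ₀', δ₀' ∈ Q.support := by
    obtain ⟨d, hd⟩ := MvPolynomial.ne_zero_iff.1 hQ; exact ⟨d, MvPolynomial.mem_support_iff.2 hd⟩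
  -- every monomial of `P` has the bookkeeping of `δ₀` (compare both with `δ₀'`), and dually
  have hProw : ∀ δ ∈ P.support, ∀ k, (∑ j, δ (k, j)) = ∑ j, δ₀ (k, j) := fun δ hδ k => by
    have h1 := hrow δ hδ δ₀' hδ₀' k; have h2 := hrow δ₀ hδ₀ δ₀' hδ₀' k; omega
  have hPcol : ∀ δ ∈ P.support, ∀ j, (∑ k, δ (k, j)) = ∑ k, δ₀ (k, j) := fun δ hδ j => by
    have h1 := hcol δ hδ δ₀' hδ₀' j; have h2 := hcol δ₀ hδ₀ δ₀' hδ₀' j; omega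
  have hQrow : ∀ δ' ∈ Q.support, ∀ k, (∑ j, δ' (k, j)) = ∑ j, δ₀' (k, j) := fun δ' hδ' k => by
    have h1 := hrow δ₀ hδ₀ δ' hδ' k; have h2 := hrow δ₀ hδ₀ δ₀' hδ₀' k; omega
  have hQcol : ∀ δ' ∈ Q.support, ∀ j, (∑ k, δ' (k, j)) = ∑ k, δ₀' (k, j) := fun δ' hδ' j => by
    have h1 := hcol δ₀ hδ₀ δ' hδ' j; have h2 := hcol δ₀ hδ₀ δ₀' hδ₀' j; omega
  have h00row := hrow δ₀ hδ₀ δ₀' hδ₀'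
  have h00col := hcol δ₀ hδ₀ δ₀' hδ₀'
  set T : Finset (Fin (n + 1)) := univ.filter (fun j : Fin (n + 1) => j.val ≤ 0) with hT
  refine ⟨univ.filter (fun k => (∑ j, δ₀ (k, j)) = 1), fun j => ∑ k, δ₀ (k, j), fun j => ∑ k, δ₀' (k, j),
    ∑ j ∈ T, ∑ k, δ₀ (k, j), ∑ j ∈ T, ∑ k, δ₀' (k, j), ?_, ?_, ?_, fun j _ => h00col j, ?_⟩
  · -- `|I| = s`
    have h1 : (univ.filter (fun k => (∑ j, δ₀ (k, j)) = 1)).card = ∑ k, ∑ j, δ₀ (k, j) := by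
      rw [Finset.card_filter]
      refine Finset.sum_congr rfl fun k _ => ?_
      have := h00row k
      split_ifs with h
      · exact h.symm
      · omega
    rw [h1, ← sum_eq_sum_rows]
    exact hdegP δ₀ hδ₀
  · -- `P` is typed
    intro δ hδ
    refine ⟨fun k => ?_, fun j _ => hPcol δ hδ j, ?_⟩
    · rw [hProw δ hδ k]
      simp only [mem_filter, mem_univ, true_and]
      have := h00row k
      split_ifs with h
      · exact h
      · omega
    · exact Finset.sum_congr rfl fun j _ => hPcol δ hδ j
  · -- `Q` is typed by the complementary data
    intro δ' hδ'
    refine ⟨fun k => ?_, fun j _ => hQcol δ' hδ' j, ?_⟩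
    · rw [hQrow δ' hδ' k]
      simp only [mem_compl, mem_filter, mem_univ, true_and]
      have := h00row k
      split_ifs with h
      · omega
      · omega
    · exact Finset.sum_congr rfl fun j _ => hQcol δ' hδ' j
  · -- tied totals (the tie `k = 0` ties the single column `0`)
    rw [← Finset.sum_add_distrib]
    have hT0 : T = {0} := by
      ext j
      simp only [hT, mem_filter, mem_univ, true_and, mem_singleton, Nat.le_zero]
      exact ⟨fun h => Fin.ext h, fun h => by rw [h]; rfl⟩
    rw [hT0, Finset.sum_singleton, Finset.card_singleton]
    exact h00col 0

end PerInvariantTyping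

end Summit.ValiantsHypothesis.ValiantsHypothesis.Theorems.FreeSubtorusOrbitDimensionBound

end
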